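import Mathlib.Topology.Separation.Profinite
import Mathlib.Topology.LocallyConstant.Basic
import HarnessLib

/-!
# Locally constant extension from local eventual constancy on a COMPACT totally disconnected space — no density hypothesis

Topic `Topology`; namespace `Literature.Topology`.  THEOREMS ONLY (no definition, no instance, no notation, no named fact, no `sorry`).
Companion of ★ `Literature/Topology/LocallyConstantExtendOfEventuallyConst.lean` (A-p16 (g27): the same conclusion under `Dense U`).  Here `U ⊆ X` is
ARBITRARY and `X` is compact Hausdorff totally disconnected (e.g. a compact torus `Z(t₀) ≅ (E_w¹)³` of a `p`-adic unitary group): if at EVERY point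
`x ∈ X` the function `F` is eventually (near `x`, along `U`) equal to some constant, then `F|_U` is the restriction of a locally constant `g : X → Y`.
Proof: clopen sets form a basis (`isTopologicalBasis_isClopen`), so every `x` has a clopen neighbourhood on which `F|_U` is constant; finitely many
cover `X` (compactness); peel them off one at a time (`Finset` induction, `if y ∈ W then c else g′ y` on the clopen `W`).  This is the gluing step of the
letter-side assembly (G4) of the rank-one unstable transfer letter `RankOneUnstableTransferNonsplitCM…` (cell `pub/hodgecm-mathlib`, road «R1LL-tree»,
LEAD F0P3a-plan (g10) WORD T9-8 (A)), where `U = {t | Reg ↑t}` for an ARBITRARY admissible regular set `Reg` (not necessarily dense).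

* `exists_isLocallyConstant_eqOn_of_clopen_cover` — the finite clopen-cover form (any topological space).
* `exists_isLocallyConstant_eqOn_of_forall_eventually_eq_of_compactSpace` — the compact totally disconnected form.

HONEST LABEL: elementary topology; HC_CM is proved only modulo the printed citations until rung 0 closes.

## References
* [BourbakiGT1] N. Bourbaki, *General Topology* I, Ch. I §8.3; Ch. II §4 (totally disconnected compact spaces have a clopen basis).
* [Rogawski1990] J. D. Rogawski, *Automorphic Representations of Unitary Groups in Three Variables* (1990), §4.9 Lemma 4.9.3 p. 56 (the consumer).
-/

set_option autoImplicit false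

open Set Filter Topology

namespace Literature.Topology

variable {X Y : Type*} [TopologicalSpace X]

/-- **Gluing constants over a finite clopen cover.**  If finitely many CLOPEN sets `W i` (`i ∈ s`) cover `S ⊆ X` and on each `W i` the function
`F` is constant `= c i` along `U`, then some locally constant `g : X → Y` agrees with `F` on `S ∩ U` — provided `X → Y` has a locally constant
function at all (`g₀`, e.g. a constant). [cite: BourbakiGT1, Ch. I §8.3] -/
theorem exists_isLocallyConstant_eqOn_of_clopen_cover {ι : Type*} (s : Finset ι) (W : ι → Set X) (c : ι → Y)
    (hW : ∀ i ∈ s, IsClopen (W i)) (U : Set X) (F : X → Y) (hF : ∀ i ∈ s, ∀ y ∈ W i, y ∈ U → F y = c i)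
    (g₀ : X → Y) (hg₀ : IsLocallyConstant g₀) :
    ∀ S : Set X, S ⊆ (⋃ i ∈ s, W i) → ∃ g : X → Y, IsLocallyConstant g ∧ EqOn g F (S ∩ U) := by
  classical
  induction s using Finset.induction_on with
  | empty =>
    intro S hS
    refine ⟨g₀, hg₀, ?_⟩
    intro y hy
    have : y ∈ (⋃ i ∈ (∅ : Finset ι), W i) := hS hy.1
    simp at this
  | @insert i₀ s hi₀ ih =>
    intro S hS
    have hW₀ : IsClopen (W i₀) := hW i₀ (Finset.mem_insert_self _ _)
    obtain ⟨g', hg', hg'F⟩ := ih (fun i hi => hW i (Finset.mem_insert_of_mem hi)) (fun i hi => hF i (Finset.mem_insert_of_mem hi))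
      (S \ W i₀) (by
        intro y hy
        have hy' := hS hy.1
        rw [Finset.set_biUnion_insert] at hy'
        rcases hy' with h | h
        · exact absurd h hy.2
        · exact h)
    refine ⟨fun y => if y ∈ W i₀ then c i₀ else g' y, ?_, ?_⟩
    · refine (IsLocallyConstant.iff_eventually_eq _).2 fun x => ?_
      by_cases hx : x ∈ W i₀
      · filter_upwards [hW₀.isOpen.mem_nhds hx] with y hy
        rw [if_pos hy, if_pos hx]
      · have hev : ∀ᶠ y in 𝓝 x, g' y = g' x := (IsLocallyConstant.iff_eventually_eq _).1 hg' x
        filter_upwards [hW₀.compl.isOpen.mem_nhds hx, hev] with y hy hyg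
        rw [if_neg hy, if_neg hx, hyg]
    · intro y hy
      by_cases hy₀ : y ∈ W i₀
      · simp only [if_pos hy₀]
        exact (hF i₀ (Finset.mem_insert_self _ _) y hy₀ hy.2).symm
      · simp only [if_neg hy₀]
        exact hg'F ⟨⟨hy.1, hy₀⟩, hy.2⟩

/-- **Locally constant extension from local eventual constancy, compact totally disconnected case (NO density).**  `X` compact Hausdorff totally
disconnected, `U ⊆ X` arbitrary: if for every `x` there is a constant `c` with `F = c` along `U` near `x`, then there is a locally constant
`g : X → Y` with `g = F` on `U`. [cite: BourbakiGT1, Ch. II §4] [cite: Rogawski1990, §4.9 Lemma 4.9.3 p. 56] -/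
theorem exists_isLocallyConstant_eqOn_of_forall_eventually_eq_of_compactSpace [CompactSpace X] [T2Space X] [TotallyDisconnectedSpace X]
    (U : Set X) (F : X → Y) (h : ∀ x : X, ∃ c : Y, ∀ᶠ y in 𝓝 x, y ∈ U → F y = c) :
    ∃ g : X → Y, IsLocallyConstant g ∧ EqOn g F U := by
  classical
  rcases isEmpty_or_nonempty X with hX | ⟨⟨x₀⟩⟩
  · exact ⟨F, (IsLocallyConstant.iff_eventually_eq F).2 fun x => isEmptyElim x, fun _ _ => rfl⟩
  choose c hc using h
  -- a clopen neighbourhood of each point on which `F|_U ≡ c x`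
  have hW : ∀ x : X, ∃ W : Set X, IsClopen W ∧ x ∈ W ∧ ∀ y ∈ W, y ∈ U → F y = c x := by
    intro x
    obtain ⟨V, hV, hVF⟩ := (hc x).exists_mem
    obtain ⟨W, hWc, hxW, hWV⟩ := (isTopologicalBasis_isClopen (X := X)).mem_nhds_iff.1 hV
    exact ⟨W, hWc, hxW, fun y hy hyU => hVF y (hWV hy) hyU⟩
  choose W hWc hxW hWF using hW
  -- finitely many of them cover the compact `X`
  obtain ⟨s, hs⟩ := isCompact_univ.elim_finite_subcover W (fun x => (hWc x).isOpen) fun x _ => mem_iUnion.2 ⟨x, hxW x⟩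
  obtain ⟨g, hg, hgF⟩ := exists_isLocallyConstant_eqOn_of_clopen_cover s W c (fun x _ => hWc x) U F (fun x _ => hWF x)
    (fun _ => c x₀) (IsLocallyConstant.const _) univ hs
  exact ⟨g, hg, fun y hy => hgF ⟨mem_univ y, hy⟩⟩

end Literature.Topology
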